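import Summits.QuantumFields.BalabanUV.T4Continuum.Spine.NE3.PairLandauB8End
import Summits.QuantumFields.BalabanUV.T4Continuum.Support.NE3CurlPairedResidualGaugeQuotient
import HarnessLib

/-!
# T⁴ programme, node NE3 — REPAIR R3, THE END ON B8's SURFACE OVER `sfClass`: the covariant root from `PairLandauGaugeB8Avg`, the per-pair
# decomposition supplier on `slicB8`, the TANGENT PROJECTION BOUND on `slicB8` (in place of (RES♯), which is discharged by R♯5d through the
# gauge quotient), (P♮) on `slicB8`, and k-free letters — background unitarity discharged by name

Cell `pub-balaban-gaps` (YM blitz, track G2, seat `ne3`, unit `pub-balaban-gaps-ne3`; writer prover-pub-balaban-gaps-ne3-g2-0, 2026-08-22), census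
`run/shared/lean/pub/pub-balaban-gaps/ne/NE3.md` §6 (5) ∕ §4 R24–R25.  Inputs BY NAME (all landed): `Spine/NE3/PairLandauB8End.ne3EnergyRateWCov_of_pairLandauGaugeB8Avg`
(p342474, the class-generic END on B8's surface), `Support/NE3CurlPairedResidualGaugeQuotient.curlPairedResidual_sfClass_of_tangentProjection` (p342348: (RES♯) on any
direction set from R♯5d `NE3CurlPairedResidualScale.curlPairedResidual_regular_residualScale` plus a `TangentProjectionBound`), `NE3EnergyChartLeaves.isUnitaryCfg_cavg_of_regular`.

CONTENT (0 sorry, no `def`): **`ne3EnergyRateWCov_sfClass_of_pairLandauGaugeB8Avg`** (`d ≥ 2`, `L, N ≥ 1`, `0 ≤ b < ε`, `g > 0`, row Y9's multi-level smallness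
`LevelSmall d L (j+1) (ε∕(L^{j+2})²)` at every level).  HYPOTHESES: `PairLandauGaugeB8Avg d (sfClass d L N ε) L N b g s₁ s₂ 1 dom`; per pair (levels `j+1`∕`j+2`)
and per representative `(u, Z)` with `LandauRepB8Avg L N (j+1) W U_A u Z s₁ s₂ 1` (`W = cavg L U_B`): the SUPPLIER `DecomposedRepT (sfClass …) L N (j+1) V U_A U_B u X N
(slicB8 L N (j+1) W) α αN ν κ₁ κ₂ a` with `pathΓ X N 0 = Z`, `α ≤ 1∕40`, `αN ≤ 1∕100`, (J1) with `e^{10(α+αN)}`, (J2); (P♮) `SlicePoincare L (j+1) W (slicB8 …) CP …`;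
the TANGENT PROJECTION BOUND `TangentProjectionBound L (j+1) W (slicB8 …) {skew ∧ periodic ∧ TangentIter L j W} K …`; uniformly `0 ≤ CP`, `CP(√Λ−1)² ≤ 1∕4`,
`0 ≤ ν`, `0 ≤ K`, budget on `θ = 2(1+4√(16d+1))ν`, `κ = 2κ₁ + 912dκ₂`.  CONCLUSION: **`NE3EnergyRateWCov d (sfClass d L N ε) L N b g ((1+θ₀)(4∕cΛ)(K·C′)) s₁ s₂ dom`**
with the LEVEL-FREE `C′` of R♯5d and `θ₀ = ν + 23√2√(16d+1)(1+ν)`.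

SO THAT the local half of NE3 on B8's surface, over Bałaban's all-small-field class, is a KERNEL COMPOSITION from: the printed TYPES [Balaban1985Variational] Thm 1
((H∃): hidden in the quantifier data and in `PairLandauGaugeB8Avg`), [Balaban1985RegularSpaces] Thm 2 (`PairLandauGaugeB8Avg`), [Balaban1985BackgroundPropagators]
Thm 3.3 ((P♮) on `slicB8`, hypothesis by the cell's rule) — and TWO unprinted inputs of ours, both NAMED: the supplier (census R24 (β)(γ)) and the tangent
projection bound (census R25, k-free exactly at `d = 4`).

HONEST FRAMING.  An implication; every hypothesis is OPEN for Bałaban's minimisers; NOTHING of Bałaban's is proved; the covariant root and **NE3 are NOT proved**;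
spine PROVED 0∕9; finite T⁴ rung (B)+1 — NOT infinite volume, NOT mass gap, NOT `BetaPertH`, NOT Clay.  ABSOLUTE RULE kept.  PLACEMENT:
`Summits/QuantumFields/BalabanUV/T4Continuum/Spine/NE3/`; imports accepted modules only; moves nothing.  HONEST DEPENDENCY: continuum YM on T⁴ ⇐ BetaPertH ∧ nine
spine estimates (0/9 proved); BetaPertH ⇐ (D1) ∧ (D4) ∧ CAP+tail; G-an2-4 gates asym, D1 and NE2/3/4.
-/

set_option autoImplicit false

open scoped BigOperators Matrix Matrix.Norms.L2Operator
open NormedSpace Finset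

namespace Summit.QuantumFields.BalabanUV.T4Continuum.NE3.PairLandauB8EndSfClass

open Set
open Literature.MathematicalPhysics.QuantumFieldTheory.Balaban1983to89
open B7Prop1Explicit B7Prop2Explicit
open T4AveragingDeficitWall hiding Site Plane Plaq Bond
open T4AveragingDeficitWallBoundary (IsPeriodicCfg periodBox)
open AveragingDeficitPeriodicCounting (IsPeriodicDir)
open AveragingDeficitChartCalculus (cavg)
open AveragingDeficitMultiLevelPrep (LevelSmall TangentIter)
open MinimalActionSandwich (IsMinimiser)
open MinimalActionRate (Regular sfClass)
open NE3EnergyShapes (residualScale residualScale_nonneg)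
open NE3EnergyWeightedShapes (energyNormW CurlPairedResidual)
open NE3EnergyWeightedCovShape (NE3EnergyRateWCov)
open NE3SlicePoincareShape (SlicePoincare)
open NE3EnergyRateWSupOfSlicePoincare (cLambda)
open NE3EnergyChartLeaves (isUnitaryCfg_cavg_of_regular)
open NE3ProductPath (pathΓ)
open NE3ProductPathChartSlice (DecomposedRepT)
open NE3CurlPairedResidualGaugeQuotient (TangentProjectionBound curlPairedResidual_sfClass_of_tangentProjection)
open NE3.PairLandauB8Avg (LandauRepB8Avg PairLandauGaugeB8Avg slicB8)
open NE3.PairLandauB8End (ne3EnergyRateWCov_of_pairLandauGaugeB8Avg)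

noncomputable section

variable {d : ℕ} {n : Type*} [Fintype n] [DecidableEq n]

/-- **THE END ON B8's SURFACE OVER `sfClass`** (see the module docstring): `NE3EnergyRateWCov d (sfClass d L N ε) L N b g ((1+θ₀)(4∕cΛ)(K·C′_{R♯5d})) s₁ s₂ dom`
from `PairLandauGaugeB8Avg`, the per-pair supplier `DecomposedRepT` on `slicB8` starting at the B8 direction, (P♮) on `slicB8`, the tangent projection
bound on `slicB8`, and the k-free letters; (RES♯) and the background's unitarity discharged by name. [folklore] -/
theorem ne3EnergyRateWCov_sfClass_of_pairLandauGaugeB8Avg [Nonempty n] (hd : 2 ≤ d) {L N : ℕ} [NeZero L] [NeZero N] (hL : 1 ≤ L)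
    (hN : 1 ≤ N) {ε b g : ℝ} (hb : 0 ≤ b) (hbε : b < ε) (hg : 0 < g)
    (hsmall : ∀ j : ℕ, LevelSmall d L (j + 1) (ε / ((L : ℝ) ^ (j + 2)) ^ 2))
    {dom : Set (Site d → Fin d → (Matrix n n ℂ)ˣ)} {s₁ s₂ ν κ₁ κ₂ CP Λ K : ℝ}
    (hCP : 0 ≤ CP) (hreg₁ : CP * (Real.sqrt Λ - 1) ^ 2 ≤ 1 / 4) (hν : 0 ≤ ν) (hK : 0 ≤ K)
    (hbudget : 2 * Λ * (2 * (1 + 4 * Real.sqrt (16 * d + 1)) * ν) + Λ * (2 * (1 + 4 * Real.sqrt (16 * d + 1)) * ν) ^ 2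
        + (2 * κ₁ + 912 * d * κ₂) ≤ cLambda n CP Λ / 2)
    (hB8 : PairLandauGaugeB8Avg d (sfClass d L N ε) L N b g s₁ s₂ 1 dom)
    (hsupp : ∀ j : ℕ, ∀ V ∈ dom, ∀ UA UB : Site d → Fin d → (Matrix n n ℂ)ˣ,
      IsMinimiser d (sfClass d L N ε) L N (j + 1) V UA → IsMinimiser d (sfClass d L N ε) L N (j + 2) V UB → Regular d L N b g (j + 2) UB →
      ∀ (u : Site d → (Matrix n n ℂ)ˣ) (Z : Site d → Fin d → Matrix n n ℂ), LandauRepB8Avg L N (j + 1) (cavg L UB) UA u Z s₁ s₂ 1 →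
        ∃ (X Nn : Site d → Fin d → Matrix n n ℂ) (α αN a : ℝ),
          DecomposedRepT (sfClass d L N ε) L N (j + 1) V UA UB u X Nn (slicB8 L N (j + 1) (cavg L UB)) α αN ν κ₁ κ₂ a ∧
          pathΓ X Nn 0 = Z ∧ α ≤ 1 / 40 ∧ αN ≤ 1 / 100 ∧
          (1 + 24 * Real.sqrt d * (Real.exp (10 * (α + αN)) - 1) * (L : ℝ) ^ (j + 1)) ^ 2 + 48 * d * a * ((L : ℝ) ^ (j + 1)) ^ 2 ≤ Λ ∧
          112 * (d : ℝ) * a * CP * ((L : ℝ) ^ (j + 1)) ^ 2 ≤ 1 / (2 * (Fintype.card n : ℝ)) ∧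
          SlicePoincare L (j + 1) (cavg L UB) (slicB8 L N (j + 1) (cavg L UB)) CP (periodBox (N * L ^ (j + 1))) ∧
          TangentProjectionBound L (j + 1) (cavg L UB) (slicB8 L N (j + 1) (cavg L UB))
            {Y | IsSkewDir Y ∧ IsPeriodicDir Y ((N * L ^ (j + 1) : ℕ) : ℤ) ∧ TangentIter L j (cavg L UB) Y} K
            (periodBox (N * L ^ (j + 1)))) :
    NE3EnergyRateWCov d (sfClass d L N ε) L N b g
      ((1 + (ν + 23 * Real.sqrt 2 * Real.sqrt (16 * d + 1) * (1 + ν))) * (4 / cLambda n CP Λ)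
        * (K * (Real.sqrt ((L : ℝ) ^ (d - 2))
            + (Real.sqrt ((L : ℝ) ^ (d - 2)) * Real.sqrt (8 * Fintype.card (T4AveragingDeficitWall.Plane d))
                * (128 * (d * (L : ℝ) ^ 2))
              + 2 * (2048 * ((d : ℝ) + 4) ^ 2 * (L : ℝ) ^ 2 * Real.sqrt (d * (L : ℝ) ^ d))) * b
            + b ^ 2 * (2 * (L : ℝ) ^ (d - 1) + 2 * (8 * d * (L : ℝ) ^ d)) * Real.sqrt (d / (g * (L : ℝ) ^ (d + 2))))))
      s₁ s₂ dom := by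
  have hC0 : 0 ≤ Real.sqrt ((L : ℝ) ^ (d - 2))
      + (Real.sqrt ((L : ℝ) ^ (d - 2)) * Real.sqrt (8 * Fintype.card (T4AveragingDeficitWall.Plane d))
          * (128 * (d * (L : ℝ) ^ 2))
        + 2 * (2048 * ((d : ℝ) + 4) ^ 2 * (L : ℝ) ^ 2 * Real.sqrt (d * (L : ℝ) ^ d))) * b
      + b ^ 2 * (2 * (L : ℝ) ^ (d - 1) + 2 * (8 * d * (L : ℝ) ^ d)) * Real.sqrt (d / (g * (L : ℝ) ^ (d + 2))) := by
    positivity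
  have hC' := mul_nonneg hK hC0
  refine ne3EnergyRateWCov_of_pairLandauGaugeB8Avg (by omega) hL hN hCP hreg₁ hν hC' hbudget hB8 ?_
  intro k hk V hV UA UB hA hB hreg u Z hZ
  obtain ⟨j, rfl⟩ : ∃ j, k = j + 1 := ⟨k - 1, by omega⟩
  have hW : IsUnitaryCfg (cavg L UB) := isUnitaryCfg_cavg_of_regular hL j hb hbε (hsmall j) hreg
  obtain ⟨X, Nn, α, αN, a, hdec, hΓ0, hα, hαN, hJ1, hJ2, hP, hproj⟩ := hsupp j V hV UA UB hA hB hreg u Z hZ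
  have hres := curlPairedResidual_sfClass_of_tangentProjection hd hL hN j hb hbε hg (hsmall j) hB hreg hproj
  rw [← mul_assoc] at hres
  exact ⟨hW, X, Nn, α, αN, a, hdec, hΓ0, hα, hαN, hJ1, hJ2, hP, hres⟩

end

end Summit.QuantumFields.BalabanUV.T4Continuum.NE3.PairLandauB8EndSfClass
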